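import Summits.QuantumFields.YangMills.Theorems.ConvexGribovBodyBrascampLiebVacuumSCFloorCentralInvolutionsOrbit

/-!
# Crux `BrascampLiebVacuumSC` (stmt-QuantumFields-16404), line `SketchIdeator1`:
# block freeing (`stub_blockAvgFloor`)

Worker file for skeleton v5 of the line lead c2
(`Cruxes/BrascampLiebVacuumSC/Lines/SketchIdeator1.lean`). The `|ι|`-link version of
`CentralInvolutions.oneLink_floor`: for an injective finite family of links `emb : ι → Edge` of
the torus `(2S+1)⁴`, a one-link locality bound `B` of the Wilson action, and a continuous bounded
`f ≥ 0` whose block Haar average over the links `emb ι` (the other links frozen, i.e. `f` at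
`Function.extend emb v x`, `v ∼ Haar^ι`) is `≥ σ` in every background `x`,
`E_μ[f] ≥ e^{−2|β|B|ι|} σ` under Wilson's measure `μ = wilson4 r β S`.

Proof (adapted from `CentralInvolutions.oneLink_floor`): compare the Boltzmann weight `w = e^{−βS}`
with `w₁ = w ∘ (reset of the block to 1)`; `|S(U) − S(reset U)| ≤ |ι| B` by iterating the
one-link bound over the finset `univ.image emb` (`BlockAvgFloor.abs_sub_piecewise_le`), so
`e^{−|β||ι|B} w₁ ≤ w` and `e^{−|β||ι|B} w ≤ w₁`; integrate the block first (Mathlib's `lmarginal`,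
`lintegral_le_of_lmarginal_le`), where `w₁` is constant and the block integral of `f` is the
hypothesis after reindexing `ι ≃ ↥(univ.image emb)` (`measurePreserving_piCongrLeft`,
`BlockAvgFloor.lintegral_updateFinset_eq_extend`); the two comparison factors and `Z` cancel.
Everything is proved; no named facts.
-/

set_option autoImplicit false

open scoped BigOperators Topology Matrix
open Filter MeasureTheory ProbabilityTheory
open Literature.MathematicalPhysics.QuantumFieldTheory
open Summit.QuantumFields.YangMills.Cruxes.CovarianceBound.SupportWindow
  (froSq coulombF IsCoulMin gluon modeCov supCov wilson4)

noncomputable section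

namespace Summit.QuantumFields.YangMills.Theorems.BrascampLiebVacuumSC

open scoped ENNReal
open Summit.QuantumFields.YangMills.Theorems.BrascampLiebVacuum.Negative
open Summit.QuantumFields.YangMills.Theorems.BrascampLiebVacuumSC.Negative

namespace BlockAvgFloor

/-- Iterating a one-coordinate locality bound: overriding the coordinates of `U` in a finset `t`
(by the values of `y`) changes `S` by at most `t.card * B`. [folklore] -/
theorem abs_sub_piecewise_le {E H : Type} [DecidableEq E] (S : (E → H) → ℝ) {B : ℝ}
    (hB : ∀ (U : E → H) (e : E) (g : H), |S U - S (Function.update U e g)| ≤ B)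
    (y U : E → H) (t : Finset E) : |S U - S (t.piecewise y U)| ≤ t.card * B := by
  induction t using Finset.induction_on with
  | empty => simp
  | insert a t ha ih =>
    rw [Finset.piecewise_insert, Finset.card_insert_of_notMem ha]
    calc |S U - S (Function.update (t.piecewise y U) a (y a))|
        ≤ |S U - S (t.piecewise y U)| +
            |S (t.piecewise y U) - S (Function.update (t.piecewise y U) a (y a))| :=
          abs_sub_le _ _ _
      _ ≤ t.card * B + B := add_le_add ih (hB _ _ _)
      _ = ((t.card + 1 : ℕ) : ℝ) * B := by push_cast; ring

/-- Reindexing the block integral: for an injective `emb : ι → E` and a finset `s` with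
`e ∈ s ↔ e ∈ range emb`, the integral over `y : ↥s → H` of `F (updateFinset x s y)` (the block
integral of Mathlib's `lmarginal`) is the `ν^ι`-integral of `F (Function.extend emb v x)`
(transport along `ι ≃ ↥s`, `measurePreserving_piCongrLeft`). [folklore] -/
theorem lintegral_updateFinset_eq_extend {E H ι : Type} [DecidableEq E] [Fintype ι]
    [MeasurableSpace H] (ν : Measure H) [SigmaFinite ν] {emb : ι → E}
    (hinj : Function.Injective emb) (s : Finset E) (hs : ∀ e, e ∈ s ↔ ∃ i, emb i = e)
    (F : (E → H) → ℝ≥0∞) (x : E → H) :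
    ∫⁻ y : ↥s → H, F (Function.updateFinset x s y) ∂(Measure.pi fun _ => ν) =
      ∫⁻ v : ι → H, F (Function.extend emb v x) ∂(Measure.pi fun _ => ν) := by
  have hmem : ∀ i, emb i ∈ s := fun i => (hs _).2 ⟨i, rfl⟩
  let eqv : ι ≃ ↥s := Equiv.ofBijective (fun i => (⟨emb i, hmem i⟩ : ↥s))
    ⟨fun i j hij => hinj (congrArg Subtype.val hij), fun e => by
      obtain ⟨i, hi⟩ := (hs e.1).1 e.2
      exact ⟨i, Subtype.ext hi⟩⟩
  rw [← (measurePreserving_piCongrLeft (fun _ : ↥s => ν) eqv).lintegral_comp_emb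
    (MeasurableEquiv.measurableEmbedding _) (fun y => F (Function.updateFinset x s y))]
  refine lintegral_congr fun v => ?_
  congr 1
  funext e'
  by_cases h : ∃ i, emb i = e'
  · obtain ⟨i, rfl⟩ := h
    rw [hinj.extend_apply]
    simp only [Function.updateFinset, dif_pos (hmem i)]
    exact MeasurableEquiv.piCongrLeft_apply_apply (β := fun _ => H) eqv v i
  · have he' : e' ∉ s := fun he' => h ((hs e').1 he')
    rw [Function.extend_apply' _ _ _ h]
    simp only [Function.updateFinset, dif_neg he']

end BlockAvgFloor

/-- **Block freeing (`stub_blockAvgFloor`).** The `|ι|`-link version of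
`CentralInvolutions.oneLink_floor`: let `emb : ι → Edge` be an injective family of links of the
torus `(2S+1)⁴`, `B` a one-link locality bound of the Wilson action, `f ≥ 0` continuous and
bounded, and suppose the block Haar average of `f` over the links `emb ι` (the other links frozen
at `x`, i.e. `f` evaluated at `Function.extend emb v x`, `v ∼ Haar^ι`) is at least `σ` in every
background `x`. Then `E_μ[f] ≥ e^{−2|β|B|ι|} σ` (compare `w = e^{−βS}` with `w ∘ (reset of the
block to 1)`, `|ΔS| ≤ |ι| B`, and integrate the block first by `lmarginal`). [folklore] -/
theorem stub_blockAvgFloor :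
    ∀ (G : Type) [Group G] [TopologicalSpace G] [IsTopologicalGroup G] [CompactSpace G]
    [MeasurableSpace G] [BorelSpace G] (r : LatticeRep G) (β : ℝ) (S : ℕ)
    (ι : Type) [Fintype ι] (emb : ι → Edge 4 (2 * S + 1)), Function.Injective emb →
    ∀ B : ℝ, (∀ (U : GaugeConfig 4 (2 * S + 1) G) (e : Edge 4 (2 * S + 1)) (g : G),
      |wilsonAction r.ρ U - wilsonAction r.ρ (Function.update U e g)| ≤ B) →
    ∀ f : GaugeConfig 4 (2 * S + 1) G → ℝ, Continuous f → (∀ U, 0 ≤ f U) →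
    ∀ M : ℝ, (∀ U, f U ≤ M) →
    ∀ σ : ℝ, (∀ x : GaugeConfig 4 (2 * S + 1) G,
      σ ≤ ∫ v, f (Function.extend emb v x) ∂(Measure.pi fun _ : ι => haarProbability G)) →
      Real.exp (-(2 * |β| * B * Fintype.card ι)) * σ ≤ ∫ U, f U ∂(wilson4 r β S) := by
  intro G _ _ _ _ _ _ r β S ι _ emb hinj B hB f hfc hf0 M hfM σ hkey
  classical
  -- trivial when `σ ≤ 0`
  rcases le_or_gt σ 0 with hσ | hσ
  · exact (mul_nonpos_of_nonneg_of_nonpos (Real.exp_pos _).le hσ).trans (integral_nonneg hf0)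
  -- the comparison factor `e = e^{-|β| |ι| B}`
  set e : ℝ := Real.exp (-(|β| * (Fintype.card ι * B))) with he
  have he0 : 0 < e := Real.exp_pos _
  have hee : Real.exp (-(2 * |β| * B * Fintype.card ι)) = e * e := by
    rw [he, ← Real.exp_add]; congr 1; ring
  rw [hee]
  haveI : SecondCountableTopology G :=
    (r.continuous.isClosedEmbedding r.injective).isEmbedding.secondCountableTopology
  show e * e * σ ≤ ∫ U, f U ∂(wilsonMeasure (d := 4) (L := 2 * S + 1) r.ρ β)
  set μ := wilsonMeasure (d := 4) (L := 2 * S + 1) r.ρ β with hμ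
  haveI hprob : IsProbabilityMeasure μ :=
    isProbabilityMeasure_wilsonMeasure (d := 4) (L := 2 * S + 1) r.ρ r.continuous β
  set π : Measure (GaugeConfig 4 (2 * S + 1) G) := Measure.pi fun _ => haarProbability G with hπ
  -- the block of freed links `s = emb ι` and the reset of the block to `1`
  obtain ⟨s, hs⟩ : ∃ s : Finset (Edge 4 (2 * S + 1)), s = Finset.univ.image emb := ⟨_, rfl⟩
  have hmem_iff : ∀ e', e' ∈ s ↔ ∃ i, emb i = e' := fun e' => by simp [hs]
  have hcard : s.card = Fintype.card ι := by
    rw [hs, Finset.card_image_of_injective _ hinj, Finset.card_univ]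
  set w : GaugeConfig 4 (2 * S + 1) G → ℝ := fun U => Real.exp (-β * wilsonAction r.ρ U) with hw
  set w₁ : GaugeConfig 4 (2 * S + 1) G → ℝ :=
    fun U => w (s.piecewise (1 : GaugeConfig 4 (2 * S + 1) G) U) with hw₁
  have hfm : Measurable f := hfc.measurable
  have hwm : Measurable w := ((measurable_wilsonAction r.ρ r.continuous).const_mul _).exp
  have hpm : Measurable fun U : GaugeConfig 4 (2 * S + 1) G =>
      s.piecewise (1 : GaugeConfig 4 (2 * S + 1) G) U := by
    refine measurable_pi_iff.2 fun e' => ?_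
    by_cases he' : e' ∈ s
    · simp only [Finset.piecewise_eq_of_mem _ _ _ he']
      exact measurable_const
    · simp only [Finset.piecewise_eq_of_notMem _ _ _ he']
      exact measurable_pi_apply e'
  have hw₁m : Measurable w₁ := hwm.comp hpm
  -- Boltzmann comparisons in both directions (`|S(U) - S(reset U)| ≤ |ι| B`)
  have hSB : ∀ U : GaugeConfig 4 (2 * S + 1) G,
      |wilsonAction r.ρ U - wilsonAction r.ρ (s.piecewise (1 : GaugeConfig 4 (2 * S + 1) G) U)|
        ≤ Fintype.card ι * B := fun U => by
    have h := BlockAvgFloor.abs_sub_piecewise_le (wilsonAction r.ρ) hB 1 U s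
    rwa [hcard] at h
  have hcmp1 : ∀ U, e * w₁ U ≤ w U := fun U => exp_mul_le_of_abs_sub_le (hSB U)
  have hcmp2 : ∀ U, e * w U ≤ w₁ U := fun U => by
    have h := hSB U
    rw [abs_sub_comm] at h
    exact exp_mul_le_of_abs_sub_le h
  -- the partition function
  set Z : ℝ≥0∞ := partitionFunction (d := 4) (L := 2 * S + 1) r.ρ β with hZ
  have hZeq : Z = ∫⁻ U, ENNReal.ofReal (w U) ∂π := by
    simp only [hZ, partitionFunction, wilsonWeight, withDensity_apply _ MeasurableSet.univ,
      Measure.restrict_univ, hπ, hw]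
  have hZ1 : Z⁻¹ * Z = 1 := by
    have h1 : μ Set.univ = 1 := measure_univ
    rw [hμ, wilsonMeasure, Measure.smul_apply, smul_eq_mul] at h1
    exact h1
  -- the expectation as a lintegral against product Haar measure
  have hμπ : μ = Z⁻¹ • π.withDensity (fun U => ENNReal.ofReal (w U)) := by
    simp only [hμ, wilsonMeasure, wilsonWeight, hZ, hπ, hw]
  have hvar : ∫ U, f U ∂μ = (∫⁻ U, ENNReal.ofReal (f U) ∂μ).toReal :=
    integral_eq_lintegral_of_nonneg_ae (Eventually.of_forall hf0) hfm.aestronglyMeasurable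
  have hlin : ∫⁻ U, ENNReal.ofReal (f U) ∂μ =
      Z⁻¹ * ∫⁻ U, ENNReal.ofReal (w U) * ENNReal.ofReal (f U) ∂π := by
    rw [hμπ, lintegral_smul_measure, lintegral_withDensity_eq_lintegral_mul _
      hwm.ennreal_ofReal hfm.ennreal_ofReal]
    rfl
  -- finiteness
  have hfin : ∫⁻ U, ENNReal.ofReal (f U) ∂μ ≠ ⊤ := by
    refine ne_top_of_le_ne_top (b := ∫⁻ _U, ENNReal.ofReal M ∂μ) ?_ ?_
    · rw [lintegral_const, measure_univ, mul_one]; exact ENNReal.ofReal_ne_top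
    · exact lintegral_mono fun U => ENNReal.ofReal_le_ofReal (hfM U)
  -- MAIN CHAIN (product Haar): ∫ w f ≥ e · (e · Z · σ)
  have hstep1 : ENNReal.ofReal e * ∫⁻ U, ENNReal.ofReal (w₁ U) * ENNReal.ofReal (f U) ∂π ≤
      ∫⁻ U, ENNReal.ofReal (w U) * ENNReal.ofReal (f U) ∂π := by
    rw [← lintegral_const_mul' _ _ ENNReal.ofReal_ne_top]
    refine lintegral_mono fun U => ?_
    rw [← mul_assoc, ← ENNReal.ofReal_mul he0.le]
    exact mul_le_mul_left (ENNReal.ofReal_le_ofReal (hcmp1 U)) _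
  -- the reset weight does not see the block
  have hw₁u : ∀ (x : GaugeConfig 4 (2 * S + 1) G) (y : ↥s → G),
      w₁ (Function.updateFinset x s y) = w₁ x := by
    intro x y
    simp only [hw₁]
    congr 1
    funext e'
    by_cases he' : e' ∈ s
    · simp only [Finset.piecewise_eq_of_mem _ _ _ he']
    · simp only [Finset.piecewise_eq_of_notMem _ _ _ he', Function.updateFinset, dif_neg he']
  -- the block Haar floor, transported to the block integral of `lmarginal`
  have hkey' : ∀ x : GaugeConfig 4 (2 * S + 1) G,
      ENNReal.ofReal σ ≤ ∫⁻ y : ↥s → G, ENNReal.ofReal (f (Function.updateFinset x s y))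
        ∂(Measure.pi fun _ => haarProbability G) := by
    intro x
    have hcont : Continuous fun v : ι → G => f (Function.extend emb v x) := by
      refine hfc.comp (continuous_pi fun e' => ?_)
      by_cases h : ∃ i, emb i = e'
      · obtain ⟨i, rfl⟩ := h
        simp only [hinj.extend_apply]
        exact continuous_apply i
      · simp only [Function.extend_apply' _ _ _ h]
        exact continuous_const
    refine (?_ : ENNReal.ofReal σ ≤ ∫⁻ v : ι → G, ENNReal.ofReal (f (Function.extend emb v x))
      ∂(Measure.pi fun _ => haarProbability G)).trans_eq
      (BlockAvgFloor.lintegral_updateFinset_eq_extend (haarProbability G) hinj s hmem_iff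
        (fun U => ENNReal.ofReal (f U)) x).symm
    rw [← ofReal_integral_eq_lintegral_ofReal
      (hcont.integrable_of_hasCompactSupport (HasCompactSupport.of_compactSpace _))
      (Eventually.of_forall fun v => hf0 _)]
    exact ENNReal.ofReal_le_ofReal (hkey x)
  have hstep2 : ∫⁻ U, ENNReal.ofReal (w₁ U) * ENNReal.ofReal σ ∂π ≤
      ∫⁻ U, ENNReal.ofReal (w₁ U) * ENNReal.ofReal (f U) ∂π := by
    have hΦm : Measurable fun U => ENNReal.ofReal (w₁ U) * ENNReal.ofReal (f U) :=
      hw₁m.ennreal_ofReal.mul hfm.ennreal_ofReal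
    have hΨm : Measurable fun U => ENNReal.ofReal (w₁ U) * ENNReal.ofReal σ :=
      hw₁m.ennreal_ofReal.mul measurable_const
    rw [hπ]
    refine lintegral_le_of_lmarginal_le s hΨm hΦm fun x => ?_
    simp only [lmarginal, hw₁u]
    calc ∫⁻ _y : ↥s → G, ENNReal.ofReal (w₁ x) * ENNReal.ofReal σ
          ∂(Measure.pi fun _ => haarProbability G)
        = ENNReal.ofReal (w₁ x) * ENNReal.ofReal σ := by
          rw [lintegral_const, measure_univ, mul_one]
      _ ≤ ENNReal.ofReal (w₁ x) *
          ∫⁻ y : ↥s → G, ENNReal.ofReal (f (Function.updateFinset x s y))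
            ∂(Measure.pi fun _ => haarProbability G) := mul_le_mul_right (hkey' x) _
      _ = ∫⁻ y : ↥s → G, ENNReal.ofReal (w₁ x) * ENNReal.ofReal (f (Function.updateFinset x s y))
            ∂(Measure.pi fun _ => haarProbability G) :=
          (lintegral_const_mul' _ _ ENNReal.ofReal_ne_top).symm
  have hstep3 : ENNReal.ofReal e * Z ≤ ∫⁻ U, ENNReal.ofReal (w₁ U) ∂π := by
    rw [hZeq, ← lintegral_const_mul' _ _ ENNReal.ofReal_ne_top]
    refine lintegral_mono fun U => ?_
    rw [← ENNReal.ofReal_mul he0.le]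
    exact ENNReal.ofReal_le_ofReal (hcmp2 U)
  -- assemble in ℝ≥0∞
  have hchain : ENNReal.ofReal e * (ENNReal.ofReal e * Z * ENNReal.ofReal σ) ≤
      ∫⁻ U, ENNReal.ofReal (w U) * ENNReal.ofReal (f U) ∂π := by
    refine le_trans ?_ hstep1
    refine mul_le_mul_right ?_ _
    refine le_trans ?_ hstep2
    rw [lintegral_mul_const' _ _ ENNReal.ofReal_ne_top]
    exact mul_le_mul_left hstep3 _
  have hgoal : ENNReal.ofReal (e * e * σ) ≤ ∫⁻ U, ENNReal.ofReal (f U) ∂μ := by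
    rw [hlin]
    calc ENNReal.ofReal (e * e * σ)
        = Z⁻¹ * (ENNReal.ofReal e * (ENNReal.ofReal e * Z * ENNReal.ofReal σ)) := by
          rw [ENNReal.ofReal_mul (by positivity), ENNReal.ofReal_mul he0.le]
          calc ENNReal.ofReal e * ENNReal.ofReal e * ENNReal.ofReal σ
              = (Z⁻¹ * Z) * (ENNReal.ofReal e * ENNReal.ofReal e * ENNReal.ofReal σ) := by
                rw [hZ1, one_mul]
            _ = _ := by ring
      _ ≤ _ := mul_le_mul_right hchain _
  rw [hvar]
  exact (ENNReal.ofReal_le_iff_le_toReal hfin).1 hgoal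

end Summit.QuantumFields.YangMills.Theorems.BrascampLiebVacuumSC

end
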